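import Summits.AtomisticToContinuum.BoseEinsteinCondensation.Theorems.BECCutLineWeakDisorderLandscapeBoundSiblingWeights
import Summits.AtomisticToContinuum.BoseEinsteinCondensation.Theorems.BECCutLineWeakDisorderLandscapeBoundSiblingTelescope
import Literature.MathematicalPhysics.QuantumManyBody.SwapPurity
import HarnessLib

/-!
# Route `BECCutLineWeakDisorder`, crux `LandscapeBound` (stmt-AtomisticToContinuum-9087),
# line `sibling-telescoping-chaining`: the sorry-free composition
# (registered bookkeeping stub `stub_siblingCompose`)

Support file (`--supports stmt-AtomisticToContinuum-9087`; proves the registered bookkeeping stub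
`stub_siblingCompose : Goal.stub_siblingCompose` of
`Theorems/BECCutLineWeakDisorderLandscapeBoundSiblingDefs.lean`): the kernel-checked composition of
the line from its registered stubs — the content of the checked skeleton
`Cruxes/LandscapeBound/Lines/sibling_telescoping_chaining.lean` minus the three open stubs.

* measurability in the bath variable of `m(Y)`, `a_Q(Y)`, `S_j(Y)`, `r̄_K(Y)`, `X_j(Y)`; elementary
  facts on the witnesses `Ψ_T = fkWitness v L T 1` (bounded by `1/√𝒩`, slices vanish off the box,
  the slice law `m(Y)dY` is a probability law); scale invariance of `r̄_K` and `X_j`;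
* `twoReplica_of_parts : HolderWeightsBound → ChainingIneq → TelescopeIneq → UVFlatness →
  IRTailsMiddle → TwoReplicaTransienceBound` — the engine crux stmt-AtomisticToContinuum-9687 BY
  NAME: telescoping `R ≤ r̄_K ∏(1 + X_j)` slice by slice, change of measure to the slice law,
  Cauchy–Schwarz, the chaining inequality fed by the per-level tails at the non-free levels and by
  `levelBound_of_free` (`X_j ≤ 7`) at the free ones; constants `ρ₀ = min`,
  `C = C_UV · exp(A(8 + 32π²)) + 1`;
* `stub_siblingCompose` — the registered stub: the six other stubs ⇒ `LandscapeBound` BY NAME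
  (`stub_witnessTransfer` = the route's crux `WitnessTransfer`, stmt-14978, by name);
  `twoReplica_of_uv_ir`, `TwoReplicaTransienceBound_of`, `LandscapeBound_of` — the same with the
  proved bookkeeping stubs supplied.

These theorems are CONDITIONAL on the open stubs (displayed `closure.modulo`); the closing file
will be the one-liner `LandscapeBound_of stub_uvFlatness stub_irTailsMiddle stub_witnessTransfer`
once the three stub files exist.
-/

noncomputable section

open MeasureTheory Filter Set Finset
open scoped ENNReal NNReal Topology BigOperators

namespace Summit.AtomisticToContinuum.BoseEinsteinCondensation.Cruxes.LandscapeBound.SiblingTelescopingChaining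

open Literature.MathematicalPhysics.QuantumManyBody.BoseGas
open Summit.AtomisticToContinuum.BoseEinsteinCondensation.Theses.BECCutLineWeakDisorder

/-! ### Measurability in the bath variable -/

section Measurability

variable {n : ℕ} {Ψ : Config (n + 1) → ℝ}

/-- The slice is jointly measurable in `(Y, x)`. [folklore] -/
theorem measurable_slice_uncurry (hΨ : Measurable Ψ) :
    Measurable fun p : Config n × Space => slice Ψ p.1 p.2 := by
  unfold slice
  exact (hΨ.comp (measurable_vecCons.comp measurable_swap)).nnnorm.coe_nnreal_ennreal

/-- Each slice is measurable. [folklore] -/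
theorem measurable_slice (hΨ : Measurable Ψ) (Y : Config n) : Measurable (slice Ψ Y) :=
  (measurable_slice_uncurry hΨ).comp (measurable_const.prodMk measurable_id)

/-- `Y ↦ s(Y) = ∫ g_Y` is measurable. [folklore] -/
theorem measurable_lintegral_slice (hΨ : Measurable Ψ) :
    Measurable fun Y : Config n => ∫⁻ x, slice Ψ Y x :=
  (measurable_slice_uncurry hΨ).lintegral_prod_right'

/-- `Y ↦ m(Y) = ∫ g_Y²` is measurable. [folklore] -/
theorem measurable_lintegral_slice_sq (hΨ : Measurable Ψ) :
    Measurable fun Y : Config n => ∫⁻ x, slice Ψ Y x ^ 2 :=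
  ((measurable_slice_uncurry hΨ).pow_const 2).lintegral_prod_right'

/-- `Y ↦ a_Q(Y)` is measurable. [folklore] -/
theorem measurable_blockMass (hΨ : Measurable Ψ) (L : ℝ) (j : ℕ) (i : Fin 3 → Fin (2 ^ j)) :
    Measurable fun Y : Config n => blockMass (slice Ψ Y) L j i := by
  unfold blockMass
  exact (measurable_slice_uncurry hΨ).lintegral_prod_right'
    (ν := (volume : Measure Space).restrict (dyadicCube L j i))

/-- `Y ↦ S_j(Y)` is measurable. [folklore] -/
theorem measurable_levelSq (hΨ : Measurable Ψ) (L : ℝ) (j : ℕ) :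
    Measurable fun Y : Config n => levelSq (slice Ψ Y) L j := by
  unfold levelSq
  exact Finset.measurable_sum _ fun i _ => (measurable_blockMass hΨ L j i).pow_const 2

/-- `Y ↦ r̄_K(Y)` is measurable. [folklore] -/
theorem measurable_uvParticipation (hΨ : Measurable Ψ) (L : ℝ) (K : ℕ) :
    Measurable fun Y : Config n => uvParticipation (slice Ψ Y) L K := by
  unfold uvParticipation
  exact (measurable_const.mul (measurable_lintegral_slice_sq hΨ)).div (measurable_levelSq hΨ L K)

/-- `Y ↦ X_j(Y)` is measurable. [folklore] -/
theorem measurable_siblingExcess (hΨ : Measurable Ψ) (L : ℝ) (j : ℕ) :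
    Measurable fun Y : Config n => siblingExcess (slice Ψ Y) L j := by
  unfold siblingExcess
  refine Measurable.sub_const ?_ _
  exact ((measurable_const.mul (measurable_levelSq hΨ L (j + 1))).ennreal_toReal).div
    (measurable_levelSq hΨ L j).ennreal_toReal

end Measurability

/-! ### The finite-`T` Feynman–Kac witnesses: elementary facts -/

section Witness

variable {n : ℕ}

/-- Degenerate normalisation makes the witness vanish identically (junk branch of `fkWitness`).
[folklore] -/
theorem fkWitness_eq_zero_of_normSq {v : ℝ → ℝ≥0∞} {L T : ℝ} {g : Config (n + 1) → ℝ≥0∞}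
    (h : fkNormSq (N := n + 1) v L T g = 0 ∨ fkNormSq (N := n + 1) v L T g = ⊤)
    (X : Config (n + 1)) : fkWitness (N := n + 1) v L T g X = 0 := by
  have h0 : (fkNormSq (N := n + 1) v L T g).toReal = 0 := by
    rcases h with h | h
    · rw [h, ENNReal.toReal_zero]
    · rw [h, ENNReal.toReal_top]
  rw [fkWitness_apply, h0, Real.sqrt_zero, div_zero]

/-- The witness with flat datum is bounded: `Ψ_T(X) ≤ 1/√‖e^{-TH}1‖₂²` (`Z_T ≤ 1`). [folklore] -/
theorem fkWitness_one_le_inv_sqrt (v : ℝ → ℝ≥0∞) (L T : ℝ) (X : Config (n + 1)) :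
    fkWitness (N := n + 1) v L T (fun _ => (1 : ℝ≥0∞)) X ≤
      1 / Real.sqrt (fkNormSq (N := n + 1) v L T (fun _ => (1 : ℝ≥0∞))).toReal := by
  rw [fkWitness_apply]
  refine div_le_div_of_nonneg_right ?_ (Real.sqrt_nonneg _)
  have h1 : fkSemigroup v L T (fun _ => (1 : ℝ≥0∞)) X ≤ 1 := fkPartition_le_one v L T X
  refine ENNReal.toReal_le_of_le_ofReal zero_le_one ?_
  rwa [ENNReal.ofReal_one]

/-- The slice of the witness vanishes off the box (Dirichlet condition in the tagged
coordinate). [folklore] -/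
theorem slice_fkWitness_eq_zero (v : ℝ → ℝ≥0∞) {L T : ℝ} (hT : 0 ≤ T) (g : Config (n + 1) → ℝ≥0∞)
    (Y : Config n) {x : Space} (hx : x ∉ box L) :
    slice (fkWitness (N := n + 1) v L T g) Y x = 0 := by
  unfold slice
  have hX : Matrix.vecCons x Y ∉ boxN (n + 1) L := by
    intro hmem
    exact hx (by simpa using hmem 0)
  rw [fkWitness_of_notMem v hT g hX]
  simp

/-- `‖r‖₊ = ofReal r` for the nonnegative witness. [folklore] -/
theorem coe_nnnorm_fkWitness (v : ℝ → ℝ≥0∞) (L T : ℝ) (g : Config (n + 1) → ℝ≥0∞)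
    (X : Config (n + 1)) :
    ((‖fkWitness (N := n + 1) v L T g X‖₊ : ℝ≥0∞)) =
      ENNReal.ofReal (fkWitness (N := n + 1) v L T g X) := by
  rw [← enorm_eq_nnnorm, Real.enorm_of_nonneg (fkWitness_nonneg v L T g X)]

/-- **The slice law is a probability law**: `∫ (∫ Ψ_T(x,Y)² dx) dY = 1` whenever the
normalisation is nondegenerate. [folklore] -/
theorem lintegral_lintegral_slice_sq {v : ℝ → ℝ≥0∞} (hv : Measurable v) (L T : ℝ)
    (h0 : fkNormSq (N := n + 1) v L T (fun _ => (1 : ℝ≥0∞)) ≠ 0)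
    (htop : fkNormSq (N := n + 1) v L T (fun _ => (1 : ℝ≥0∞)) ≠ ⊤) :
    ∫⁻ Y : Config n, ∫⁻ x, slice (fkWitness (N := n + 1) v L T (fun _ => (1 : ℝ≥0∞))) Y x ^ 2 = 1 := by
  have hm : Measurable (fkWitness (N := n + 1) v L T (fun _ => (1 : ℝ≥0∞))) :=
    measurable_fkWitness hv L T measurable_const
  have key := lintegral_config_succ (n := n)
    (F := fun Z => (‖fkWitness (N := n + 1) v L T (fun _ => (1 : ℝ≥0∞)) Z‖₊ : ℝ≥0∞) ^ 2)
    (hm.nnnorm.coe_nnreal_ennreal.pow_const 2)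
  unfold slice
  rw [← key]
  simp_rw [coe_nnnorm_fkWitness]
  exact lintegral_fkWitness_sq hv L T measurable_const h0 htop

end Witness

/-! ### Scale invariance of the block statistics -/

/-- `a_Q(c·g) = c·a_Q(g)` (`c < ∞`). [folklore] -/
theorem blockMass_const_mul {c : ℝ≥0∞} (hc : c ≠ ⊤) (g : Space → ℝ≥0∞) (L : ℝ) (j : ℕ)
    (i : Fin 3 → Fin (2 ^ j)) :
    blockMass (fun x => c * g x) L j i = c * blockMass g L j i := by
  unfold blockMass
  exact lintegral_const_mul' c _ hc

/-- `S_j(c·g) = c² S_j(g)` (`c < ∞`). [folklore] -/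
theorem levelSq_const_mul {c : ℝ≥0∞} (hc : c ≠ ⊤) (g : Space → ℝ≥0∞) (L : ℝ) (j : ℕ) :
    levelSq (fun x => c * g x) L j = c ^ 2 * levelSq g L j := by
  unfold levelSq
  rw [Finset.mul_sum]
  refine Finset.sum_congr rfl fun i _ => ?_
  rw [blockMass_const_mul hc, mul_pow]

/-- **`r̄_K` is scale-free**: `uvParticipation (c·g) = uvParticipation g` for `c ∈ (0, ∞)`.
[folklore] -/
theorem uvParticipation_const_mul {c : ℝ≥0∞} (hc0 : c ≠ 0) (hc : c ≠ ⊤) (g : Space → ℝ≥0∞)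
    (L : ℝ) (K : ℕ) :
    uvParticipation (fun x => c * g x) L K = uvParticipation g L K := by
  unfold uvParticipation
  have h2 : ∫⁻ x, (c * g x) ^ 2 = c ^ 2 * ∫⁻ x, g x ^ 2 := by
    simp_rw [mul_pow]
    exact lintegral_const_mul' _ _ (ENNReal.pow_ne_top hc)
  rw [h2, levelSq_const_mul hc, mul_left_comm,
    ENNReal.mul_div_mul_left _ _ (pow_ne_zero 2 hc0) (ENNReal.pow_ne_top hc)]

/-- **`X_j` is scale-free**: `siblingExcess (c·g) = siblingExcess g` for `c ∈ (0, ∞)`.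
[folklore] -/
theorem siblingExcess_const_mul {c : ℝ≥0∞} (hc0 : c ≠ 0) (hc : c ≠ ⊤) (g : Space → ℝ≥0∞)
    (L : ℝ) (j : ℕ) :
    siblingExcess (fun x => c * g x) L j = siblingExcess g L j := by
  unfold siblingExcess
  have hc2 : (c ^ 2).toReal ≠ 0 :=
    ENNReal.toReal_ne_zero.2 ⟨pow_ne_zero 2 hc0, ENNReal.pow_ne_top hc⟩
  rw [levelSq_const_mul hc, levelSq_const_mul hc, mul_left_comm, ENNReal.toReal_mul,
    ENNReal.toReal_mul (a := c ^ 2), mul_div_mul_left _ _ hc2]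

/-! ### Composition I: the engine crux `TwoReplicaTransienceBound` from UV flatness and IR tails -/

/-- **`TwoReplicaTransienceBound` (stmt-AtomisticToContinuum-9687) from `UVFlatness` and
`IRTailsMiddle`**, sorry-free (free levels by `levelBound_of_free`): telescoping `R ≤ r̄_K ∏(1 + X_j)` slice by slice
(`landscape_le_telescope`), change of measure to the slice law `m(Y)dY` (a probability law,
`lintegral_lintegral_slice_sq`), Cauchy–Schwarz, and the two-sided polynomial-Hölder chaining
lemma `chaining_sq` fed by the per-level tails; constants `ρ₀ = min`,
`C = C_UV · exp(A(8 + 32π²)) + 1`. [folklore] -/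
theorem twoReplica_of_parts (hWt : HolderWeightsBound) (hCh : ChainingIneq) (hTe : TelescopeIneq)
    (hUV : UVFlatness) (hIR : IRTailsMiddle) : TwoReplicaTransienceBound := by
  intro v hv
  obtain ⟨ρ₁, hρ₁, H1⟩ := hUV v hv
  obtain ⟨ρ₂, hρ₂, H2⟩ := hIR v hv
  refine ⟨min ρ₁ ρ₂, lt_min hρ₁ hρ₂, fun ρ hρ hρlt => ?_⟩
  obtain ⟨CU, hCU, ev1⟩ := H1 ρ hρ (hρlt.trans_le (min_le_left _ _))
  obtain ⟨A, hA, ev2⟩ := H2 ρ hρ (hρlt.trans_le (min_le_right _ _))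
  set E : ℝ := A * (8 + 32 * Real.pi ^ 2) with hEdef
  refine ⟨CU * Real.exp E + 1, by positivity, ?_⟩
  filter_upwards [ev1, ev2] with n h1 h2 T hT
  have hvm : Measurable v := hv.1
  have hT0 : 0 ≤ T := zero_le_one.trans hT
  set L : ℝ := sideLength ρ (n + 1) with hLdef
  have hLpos : 0 < L := Real.rpow_pos_of_pos (div_pos (Nat.cast_pos.mpr n.succ_pos) hρ) _
  set K : ℕ := depth L with hKdef
  set Ψ : Config (n + 1) → ℝ := fkWitness (N := n + 1) v L T (fun _ => (1 : ℝ≥0∞)) with hΨdef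
  set 𝒩 : ℝ≥0∞ := fkNormSq (N := n + 1) v L T (fun _ => (1 : ℝ≥0∞)) with h𝒩def
  have hΨm : Measurable Ψ := measurable_fkWitness hvm L T measurable_const
  -- the goal, in the slice vocabulary
  change ∫⁻ Y : Config n, ENNReal.ofReal (L ^ 3) * (∫⁻ x, slice Ψ Y x ^ 2) ^ 2 /
      (∫⁻ x, slice Ψ Y x) ^ 2 ≤ ENNReal.ofReal (CU * Real.exp E + 1)
  -- degenerate normalisation: the witness vanishes
  by_cases hdeg : 𝒩 = 0 ∨ 𝒩 = ⊤
  · have hΨ0 : ∀ X, Ψ X = 0 := fkWitness_eq_zero_of_normSq hdeg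
    have hsl : ∀ Y x, slice Ψ Y x = 0 := fun Y x => by simp [slice, hΨ0]
    simp [hsl]
  simp only [not_or] at hdeg
  obtain ⟨h𝒩0, h𝒩t⟩ := hdeg
  -- the slice law
  set m : Config n → ℝ≥0∞ := fun Y => ∫⁻ x, slice Ψ Y x ^ 2 with hmdef
  have hm_meas : Measurable m := measurable_lintegral_slice_sq hΨm
  have hm1 : ∫⁻ Y, m Y = 1 := lintegral_lintegral_slice_sq hvm L T h𝒩0 h𝒩t
  set μ : Measure (Config n) := volume.withDensity m with hμdef
  haveI : IsProbabilityMeasure μ :=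
    ⟨by rw [hμdef, withDensity_apply _ MeasurableSet.univ, Measure.restrict_univ, hm1]⟩
  -- bound and support of the slices
  set Mr : ℝ := 1 / Real.sqrt 𝒩.toReal with hMrdef
  have hbound : ∀ Y x, slice Ψ Y x ≤ ENNReal.ofReal Mr := fun Y x => by
    show ((‖Ψ (Matrix.vecCons x Y)‖₊ : ℝ≥0∞)) ≤ ENNReal.ofReal Mr
    rw [coe_nnnorm_fkWitness]
    exact ENNReal.ofReal_le_ofReal (fkWitness_one_le_inv_sqrt v L T _)
  have h0Y : ∀ (Y : Config n) (x : Space), x ∉ box L → slice Ψ Y x = 0 := fun Y x hx =>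
    slice_fkWitness_eq_zero v hT0 _ Y hx
  -- pointwise telescoping
  set rbar : Config n → ℝ≥0∞ := fun Y => uvParticipation (slice Ψ Y) L K with hrbardef
  set Prd : Config n → ℝ := fun Y => ∏ j ∈ range K, (1 + siblingExcess (slice Ψ Y) L j) with hPrddef
  have hpt : ∀ Y, ENNReal.ofReal (L ^ 3) * (∫⁻ x, slice Ψ Y x ^ 2) ^ 2 / (∫⁻ x, slice Ψ Y x) ^ 2 ≤
      m Y * (rbar Y * ENNReal.ofReal (Prd Y)) := by
    intro Y
    have h := hTe.2 _ (measurable_slice hΨm Y) L hLpos (h0Y Y) _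
      ENNReal.ofReal_ne_top (hbound Y) K
    calc _ ≤ _ := h
      _ = m Y * (rbar Y * ENNReal.ofReal (Prd Y)) := by simp only [hmdef, hrbardef, hPrddef]; ring
  have hrbar_meas : Measurable rbar := measurable_uvParticipation hΨm L K
  have hPrd_meas : Measurable Prd := by
    refine Finset.measurable_prod _ fun j _ => ?_
    exact (measurable_siblingExcess hΨm L j).const_add 1
  have hPrdnn : ∀ Y, 0 ≤ Prd Y := fun Y => Finset.prod_nonneg fun j _ => by
    unfold siblingExcess
    have : 0 ≤ (8 * levelSq (slice Ψ Y) L (j + 1)).toReal / (levelSq (slice Ψ Y) L j).toReal :=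
      div_nonneg ENNReal.toReal_nonneg ENNReal.toReal_nonneg
    linarith
  -- Cauchy–Schwarz under the slice law
  have hCS : ∫⁻ Y, (rbar * fun Y => ENNReal.ofReal (Prd Y)) Y ∂μ ≤
      (∫⁻ Y, rbar Y ^ (2 : ℝ) ∂μ) ^ (1 / (2 : ℝ)) *
        (∫⁻ Y, ENNReal.ofReal (Prd Y) ^ (2 : ℝ) ∂μ) ^ (1 / (2 : ℝ)) :=
    ENNReal.lintegral_mul_le_Lp_mul_Lq μ Real.HolderConjugate.two_two hrbar_meas.aemeasurable
      (ENNReal.measurable_ofReal.comp hPrd_meas).aemeasurable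
  -- the UV factor
  have hUVfac : ∫⁻ Y, rbar Y ^ (2 : ℝ) ∂μ ≤ ENNReal.ofReal CU := by
    simp only [ENNReal.rpow_two]
    rw [hμdef, lintegral_withDensity_eq_lintegral_mul _ hm_meas (hrbar_meas.pow_const 2)]
    exact h1 T hT
  -- the IR factor, by chaining
  have hIRfac : ∫⁻ Y, ENNReal.ofReal (Prd Y) ^ (2 : ℝ) ∂μ ≤ ENNReal.ofReal (Real.exp E) := by
    simp only [ENNReal.rpow_two]
    let X : Fin K → Config n → ℝ := fun k Y => siblingExcess (slice Ψ Y) L k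
    let θ : Fin K → ℝ := fun k => holderWeight k (K - 1 - k)
    let B : Fin K → ℝ := fun k => levelBudget A k (K - 1 - k)
    have hXm : ∀ k, Measurable (X k) := fun k => measurable_siblingExcess hΨm L k
    have hX1 : ∀ k Y, 0 ≤ 1 + X k Y := fun k Y => by
      show 0 ≤ 1 + siblingExcess (slice Ψ Y) L k
      unfold siblingExcess
      have : 0 ≤ (8 * levelSq (slice Ψ Y) L (k + 1)).toReal / (levelSq (slice Ψ Y) L k).toReal :=
        div_nonneg ENNReal.toReal_nonneg ENNReal.toReal_nonneg
      linarith
    have hθ0 : ∀ k, 0 < θ k := fun k => holderWeight_pos _ _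
    have hθ1 : ∑ k, θ k ≤ 1 := by
      show ∑ k : Fin K, holderWeight k (K - 1 - k) ≤ 1
      rw [Fin.sum_univ_eq_sum_range (fun j => holderWeight j (K - 1 - j)) K]
      exact hWt.1 K
    have hmgf : ∀ k, ∫⁻ Y, ENNReal.ofReal (Real.exp (2 / θ k * X k Y)) ∂μ ≤
        ENNReal.ofReal (Real.exp (B k)) := by
      intro k
      by_cases hfree : A * ((2 : ℝ)⁻¹ ^ (k : ℕ) + (2 : ℝ)⁻¹ ^ (K - 1 - k)) *
          (1 + levelExponent k (K - 1 - k)) < 7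
      swap
      · exact levelBound_of_free μ (not_lt.1 hfree) (X k) fun Y => hTe.1 _ _ _
      have hjk : (k : ℕ) + (K - 1 - k) + 1 = depth (sideLength ρ (n + 1)) := by
        have := k.isLt; rw [← hKdef]; omega
      have h := h2 T hT k (K - 1 - k) hjk hfree
      rw [hμdef, lintegral_withDensity_eq_lintegral_mul _ hm_meas
        (show Measurable (fun Y => ENNReal.ofReal (Real.exp (2 / θ k * X k Y))) from
          ENNReal.measurable_ofReal.comp (Real.measurable_exp.comp ((hXm k).const_mul _)))]
      exact h
    have hch := hCh _ μ K X hXm hX1 θ hθ0 hθ1 B hmgf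
    have hPrdX : ∀ Y, Prd Y = ∏ k : Fin K, (1 + X k Y) := fun Y =>
      (Fin.prod_univ_eq_prod_range (fun j => 1 + siblingExcess (slice Ψ Y) L j) K).symm
    have hsum : ∑ k, θ k * B k ≤ E := by
      show ∑ k : Fin K, holderWeight k (K - 1 - k) * levelBudget A k (K - 1 - k) ≤ E
      rw [Fin.sum_univ_eq_sum_range (fun j => holderWeight j (K - 1 - j) * levelBudget A j (K - 1 - j)) K]
      exact hWt.2 A hA K
    calc ∫⁻ Y, ENNReal.ofReal (Prd Y) ^ 2 ∂μ = ∫⁻ Y, ENNReal.ofReal ((∏ k : Fin K, (1 + X k Y)) ^ 2) ∂μ := by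
          refine lintegral_congr fun Y => ?_
          rw [← ENNReal.ofReal_pow (hPrdnn Y), hPrdX Y]
      _ ≤ ENNReal.ofReal (Real.exp (∑ k, θ k * B k)) := hch
      _ ≤ ENNReal.ofReal (Real.exp E) := ENNReal.ofReal_le_ofReal (Real.exp_le_exp.2 hsum)
  -- assemble
  calc ∫⁻ Y, ENNReal.ofReal (L ^ 3) * (∫⁻ x, slice Ψ Y x ^ 2) ^ 2 / (∫⁻ x, slice Ψ Y x) ^ 2
      ≤ ∫⁻ Y, m Y * (rbar Y * ENNReal.ofReal (Prd Y)) := lintegral_mono hpt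
    _ = ∫⁻ Y, (rbar * fun Y => ENNReal.ofReal (Prd Y)) Y ∂μ := by
        rw [hμdef, lintegral_withDensity_eq_lintegral_mul _ hm_meas
          (show Measurable (rbar * fun Y => ENNReal.ofReal (Prd Y)) from
            hrbar_meas.mul (ENNReal.measurable_ofReal.comp hPrd_meas))]
        rfl
    _ ≤ (∫⁻ Y, rbar Y ^ (2 : ℝ) ∂μ) ^ (1 / (2 : ℝ)) *
          (∫⁻ Y, ENNReal.ofReal (Prd Y) ^ (2 : ℝ) ∂μ) ^ (1 / (2 : ℝ)) := hCS
    _ ≤ (ENNReal.ofReal CU) ^ (1 / (2 : ℝ)) * (ENNReal.ofReal (Real.exp E)) ^ (1 / (2 : ℝ)) := by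
        gcongr
    _ = (ENNReal.ofReal (CU * Real.exp E)) ^ (1 / (2 : ℝ)) := by
        rw [← ENNReal.mul_rpow_of_nonneg _ _ (by norm_num : (0:ℝ) ≤ 1 / 2),
          ← ENNReal.ofReal_mul hCU.le]
    _ ≤ ENNReal.ofReal (CU * Real.exp E) + 1 := rpow_half_le_add_one _
    _ = ENNReal.ofReal (CU * Real.exp E + 1) := by
        rw [ENNReal.ofReal_add (by positivity) zero_le_one, ENNReal.ofReal_one]

/-! ### Composition II: the crux by name -/

/-- **`TwoReplicaTransienceBound` (stmt-AtomisticToContinuum-9687) from `UVFlatness` and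
`IRTailsMiddle`** (the bookkeeping parts supplied by the proved lemmas of this file). -/
theorem twoReplica_of_uv_ir (hUV : UVFlatness) (hIR : IRTailsMiddle) : TwoReplicaTransienceBound :=
  twoReplica_of_parts stub_weights stub_chaining stub_telescope hUV hIR

/-- **By-product: the engine crux `TwoReplicaTransienceBound` (stmt-AtomisticToContinuum-9687)
BY NAME from the two analytic stubs** (kernel-checked, sorry-free composition). -/
theorem TwoReplicaTransienceBound_of :
    Goal.stub_uvFlatness → Goal.stub_irTailsMiddle →
      Summit.AtomisticToContinuum.BoseEinsteinCondensation.Theses.BECCutLineWeakDisorder.TwoReplicaTransienceBound :=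
  twoReplica_of_uv_ir

/-- PROVED bookkeeping stub `stub_siblingCompose`: **the crux `LandscapeBound`
(stmt-AtomisticToContinuum-9087) BY NAME from the six other stubs** (kernel-checked, sorry-free):
the two-replica bound for every admissible `v` (`twoReplica_of_parts`, i.e.
`TwoReplicaTransienceBound` by name), then the route's witness-transfer crux
`WitnessTransfer : TwoReplicaTransienceBound → LandscapeBound` by name. -/
theorem stub_siblingCompose : Goal.stub_siblingCompose :=
  fun hWt hCh hTe hUV hIR hW => hW (twoReplica_of_parts hWt hCh hTe hUV hIR)

/-- The crux from the three open stubs (what the closing `Theorems/` file will say once every stub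
is a theorem of the tree). -/
theorem LandscapeBound_of :
    Goal.stub_uvFlatness → Goal.stub_irTailsMiddle → Goal.stub_witnessTransfer →
      Summit.AtomisticToContinuum.BoseEinsteinCondensation.Theses.BECCutLineWeakDisorder.LandscapeBound :=
  stub_siblingCompose stub_weights stub_chaining stub_telescope

end Summit.AtomisticToContinuum.BoseEinsteinCondensation.Cruxes.LandscapeBound.SiblingTelescopingChaining

end
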